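import Mathlib

/-!
# LatticeQCDFlow / Scaling — the isoperimetric-transfer engine for ε-ACCURATE Lipschitz transport (THEORY-2.md §3.3 v2.6, (C2b′))

HONEST FRAMING: exact (Metropolis-corrected) sampling algorithms for lattice gauge theory;
figures of merit are autocorrelation/cost numbers at stated couplings and volumes; no
continuum-physics claim.

Theory seat GEN-11, conjecture (C2b′) — the abstract half, PROVED here over arbitrary pseudo-metric
measure spaces (the lattice half — the one-plaquette collar estimate and the linear isoperimetric profile of
product Haar — stays a stated input, THEORY-2.md §3.3 v2.6 (i)/(iii)).

* The hypothesis shape (written inline in every statement; no `Prop` is defined in this file, by the tree's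
  vendored-fact rule) is a LINEARISED ISOPERIMETRIC PROFILE `(a, b, c)` of a measure `μ` on a pseudo-metric space: every measurable `A` with `a ≤ μ(A)` has `μ(A^r) ≥ min(μ(A) + c·r, b)` for all `r ≥ 0`, where
  `A^r = A ∪ {x : dist(x, A) < r}` (`A ∪ Metric.thickening r A`).  (The standard Gaussian has it with `(a, b, c) =
  (0.3, 0.8, 0.28)` by Borell–Sudakov–Tsirelson; product Haar on `U(1)^E` with the `ℓ²` arc metric inherits
  `(0.3, 0.8, 0.28/√(2π))` uniformly in `E` as a `√(2π)`-Lipschitz image — THEORY-2.md §3.3 v2.6 (i); neither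
  is asserted in this file.)
* `linearIsoProfile_map_lipschitz` — TRANSFER: the profile passes to the push-forward under a `K`-Lipschitz
  map with `c ↦ c/K` (Salmona–de Bortoli–Delon–Desolneux 2022, Thm 1, in linearised form; the proof is the
  inclusion `(g⁻¹B)^{r/K} ⊆ g⁻¹(B^r)`).
* `linearIsoProfile_cost` / `accurateTransport_lipschitz_ge` — THE LAW: if `ν` has profile `(a, b, c')` and a
  target `μ` agrees with `ν` up to `ε` on the two sets `A`, `A^r`, while `μ` puts mass `≤ δ` on the collar
  `A^r ∖ A` (`μ(A^r) ≤ μ(A) + δ`) and `a ≤ μ(A) − ε`, `μ(A) + ε + δ < b`, then `c'·r ≤ 2ε + δ`; for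
  `ν = T_*γ` with `T` `K`-Lipschitz and `γ` of profile `(a, b, c)`: **`c·r ≤ K·(2ε + δ)`**, i.e.
  `Lip(T) ≥ c·r/(2ε + δ)` — LINEAR in `1/ε`, capped by the collar mass `δ`, with no other dependence on the
  target (THEORY-2.md §3.3 v2.6: on the 2-d U(1) torus `δ = #P·q_β(2r)`, giving `K ≥ 0.112·r/(2ε + #P·q_β(2r))`
  and, for exact maps, `K ≥ 0.070·e^{2β}/(#P·√β)`).
* `exactTransport_lipschitz_ge` — the `ε = 0` case: `c·r ≤ K·δ`.

No `sorry`; Mathlib only.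
-/

noncomputable section

namespace Summit.Ventures.LatticeQCDFlow.Theory2

open MeasureTheory Set Metric

variable {X Y : Type*}

/-! Throughout, the `r`-ENLARGEMENT of a set is written `A ∪ Metric.thickening r A` (for `r > 0` the open
`r`-neighbourhood of `A`; the union keeps `A ⊆ A^r` for `r ≤ 0` too).  No named definition is introduced
(a support file defines no new objects). -/

/-- `A^r` is measurable when `A` is (the thickening is open). -/
theorem measurableSet_union_thickening [PseudoMetricSpace X] [MeasurableSpace X] [OpensMeasurableSpace X]
    (r : ℝ) {A : Set X} (hA : MeasurableSet A) : MeasurableSet (A ∪ Metric.thickening r A) :=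
  hA.union Metric.isOpen_thickening.measurableSet

/-- TRANSFER INCLUSION: for a `K`-Lipschitz `g`, `(g⁻¹ B)^{r/K} ⊆ g⁻¹(B^r)`. -/
theorem union_thickening_preimage_subset [PseudoMetricSpace X] [PseudoMetricSpace Y] {g : Y → X} {K : NNReal}
    (hg : LipschitzWith K g) (hK : 0 < (K : ℝ)) (r : ℝ) (B : Set X) :
    (g ⁻¹' B) ∪ Metric.thickening (r / K) (g ⁻¹' B) ⊆ g ⁻¹' (B ∪ Metric.thickening r B) := by
  intro y hy
  rcases hy with hy | hy
  · exact Or.inl hy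
  · rw [Metric.mem_thickening_iff] at hy
    obtain ⟨z, hz, hyz⟩ := hy
    refine Or.inr ?_
    show g y ∈ Metric.thickening r B
    rw [Metric.mem_thickening_iff]
    refine ⟨g z, hz, ?_⟩
    calc dist (g y) (g z) ≤ K * dist y z := hg.dist_le_mul y z
      _ < K * (r / K) := by exact mul_lt_mul_of_pos_left hyz hK
      _ = r := by field_simp

/-- TRANSFER (Salmona–de Bortoli–Delon–Desolneux 2022, Thm 1, linearised): the push-forward of a measure with
profile `(a, b, c)` under a `K`-Lipschitz map has profile `(a, b, c/K)`. -/
theorem linearIsoProfile_map_lipschitz [PseudoMetricSpace X] [MeasurableSpace X] [BorelSpace X]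
    [PseudoMetricSpace Y] [MeasurableSpace Y] [OpensMeasurableSpace Y]
    {γ : Measure Y} [IsFiniteMeasure γ] {a b c : ℝ}
    (hγ : ∀ A : Set Y, MeasurableSet A → a ≤ γ.real A → ∀ r : ℝ, 0 ≤ r →
      min (γ.real A + c * r) b ≤ γ.real (A ∪ Metric.thickening r A))
    {g : Y → X} {K : NNReal} (hg : LipschitzWith K g) (hK : 0 < (K : ℝ)) :
    ∀ B : Set X, MeasurableSet B → a ≤ (γ.map g).real B → ∀ r : ℝ, 0 ≤ r →
      min ((γ.map g).real B + c / K * r) b ≤ (γ.map g).real (B ∪ Metric.thickening r B) := by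
  have hgm : Measurable g := hg.continuous.measurable
  intro B hB haB r hr
  have hpre : MeasurableSet (g ⁻¹' B) := hgm hB
  have hmapB : (γ.map g).real B = γ.real (g ⁻¹' B) := by
    simp [Measure.real, Measure.map_apply hgm hB]
  have hmapE : (γ.map g).real (B ∪ Metric.thickening r B) = γ.real (g ⁻¹' (B ∪ Metric.thickening r B)) := by
    simp [Measure.real, Measure.map_apply hgm (measurableSet_union_thickening r hB)]
  rw [hmapB] at haB
  have h1 := hγ (g ⁻¹' B) hpre haB (r / K) (div_nonneg hr hK.le)
  have h2 : γ.real ((g ⁻¹' B) ∪ Metric.thickening (r / K) (g ⁻¹' B)) ≤ γ.real (g ⁻¹' (B ∪ Metric.thickening r B)) :=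
    measureReal_mono (union_thickening_preimage_subset hg hK r B) (measure_ne_top _ _)
  have h3 : c * (r / K) = c / K * r := by ring
  rw [hmapB, hmapE, ← h3]
  exact h1.trans h2

/-- THE COST INEQUALITY (abstract): profile `(a, b, c')` for `ν`, agreement of `μ` and `ν` up to `ε` on
`A` and `A^r`, collar mass `μ(A^r) ≤ μ(A) + δ`, window conditions ⇒ `c'·r ≤ 2ε + δ`. -/
theorem linearIsoProfile_cost [PseudoMetricSpace X] [MeasurableSpace X]
    {ν μ : Measure X} {a b c' : ℝ}
    (hν : ∀ A : Set X, MeasurableSet A → a ≤ ν.real A → ∀ r : ℝ, 0 ≤ r →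
      min (ν.real A + c' * r) b ≤ ν.real (A ∪ Metric.thickening r A))
    {A : Set X} (hA : MeasurableSet A) {r ε δ : ℝ} (hr : 0 ≤ r)
    (h₁ : |μ.real A - ν.real A| ≤ ε)
    (h₂ : |μ.real (A ∪ Metric.thickening r A) - ν.real (A ∪ Metric.thickening r A)| ≤ ε)
    (hδ : μ.real (A ∪ Metric.thickening r A) ≤ μ.real A + δ)
    (ha : a ≤ μ.real A - ε) (hb : μ.real A + ε + δ < b) :
    c' * r ≤ 2 * ε + δ := by
  have hA1 : μ.real A - ε ≤ ν.real A := by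
    have := (abs_le.mp h₁).2; linarith
  have hE1 : ν.real (A ∪ Metric.thickening r A) ≤ μ.real (A ∪ Metric.thickening r A) + ε := by
    have := (abs_le.mp h₂).1; linarith
  have hprof := hν A hA (ha.trans hA1) r hr
  have hup : ν.real (A ∪ Metric.thickening r A) < b := by linarith
  -- the `min` cannot be attained at `b`
  have hmin : ν.real A + c' * r ≤ ν.real (A ∪ Metric.thickening r A) := by
    rcases le_or_gt (ν.real A + c' * r) b with h | h
    · rwa [min_eq_left h] at hprof
    · rw [min_eq_right h.le] at hprof
      exact absurd (hprof.trans_lt hup) (lt_irrefl b)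
  linarith

/-- **THE ISOPERIMETRIC-TRANSFER LAW for ε-accurate Lipschitz transport ((C2b′), abstract form).**  If the
prior `γ` has the linear isoperimetric profile `(a, b, c)`, `T` is `K`-Lipschitz (`K > 0`), the model
`T_*γ` agrees with the target `μ` up to `ε` on `A` and on `A^r` (in particular if `d_TV(T_*γ, μ) ≤ ε`),
the target's collar mass is `μ(A^r ∖ A) ≤ δ` in the form `μ(A^r) ≤ μ(A) + δ`, and the window conditions
`a ≤ μ(A) − ε`, `μ(A) + ε + δ < b` hold, then `c·r ≤ K·(2ε + δ)` — i.e. `Lip(T) ≥ c·r/(2ε + δ)`. -/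
theorem accurateTransport_lipschitz_ge [PseudoMetricSpace X] [MeasurableSpace X] [BorelSpace X]
    [PseudoMetricSpace Y] [MeasurableSpace Y] [OpensMeasurableSpace Y]
    {γ : Measure Y} [IsFiniteMeasure γ] {a b c : ℝ}
    (hγ : ∀ A : Set Y, MeasurableSet A → a ≤ γ.real A → ∀ r : ℝ, 0 ≤ r →
      min (γ.real A + c * r) b ≤ γ.real (A ∪ Metric.thickening r A))
    {T : Y → X} {K : NNReal} (hT : LipschitzWith K T) (hK : 0 < (K : ℝ))
    {μ : Measure X} {A : Set X} (hA : MeasurableSet A) {r ε δ : ℝ} (hr : 0 ≤ r)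
    (h₁ : |μ.real A - (γ.map T).real A| ≤ ε)
    (h₂ : |μ.real (A ∪ Metric.thickening r A) - (γ.map T).real (A ∪ Metric.thickening r A)| ≤ ε)
    (hδ : μ.real (A ∪ Metric.thickening r A) ≤ μ.real A + δ)
    (ha : a ≤ μ.real A - ε) (hb : μ.real A + ε + δ < b) :
    c * r ≤ K * (2 * ε + δ) := by
  have hprof := linearIsoProfile_map_lipschitz hγ hT hK
  have h := linearIsoProfile_cost hprof hA hr h₁ h₂ hδ ha hb
  -- `c / K * r ≤ 2ε + δ`; multiply by `K > 0`
  have h' : c * r = K * (c / K * r) := by field_simp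
  rw [h']
  exact mul_le_mul_of_nonneg_left h hK.le

/-- The EXACT case `T_*γ = μ` (`ε = 0`): `c·r ≤ K·δ`, i.e. an exact Lipschitz transport is at least as
expansive as `c·r/δ` for every set `A` in the window and every `r ≥ 0` with collar mass `δ`. -/
theorem exactTransport_lipschitz_ge [PseudoMetricSpace X] [MeasurableSpace X] [BorelSpace X]
    [PseudoMetricSpace Y] [MeasurableSpace Y] [OpensMeasurableSpace Y]
    {γ : Measure Y} [IsFiniteMeasure γ] {a b c : ℝ}
    (hγ : ∀ A : Set Y, MeasurableSet A → a ≤ γ.real A → ∀ r : ℝ, 0 ≤ r →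
      min (γ.real A + c * r) b ≤ γ.real (A ∪ Metric.thickening r A))
    {T : Y → X} {K : NNReal} (hT : LipschitzWith K T) (hK : 0 < (K : ℝ))
    {μ : Measure X} (hex : γ.map T = μ) {A : Set X} (hA : MeasurableSet A) {r δ : ℝ} (hr : 0 ≤ r)
    (hδ : μ.real (A ∪ Metric.thickening r A) ≤ μ.real A + δ) (ha : a ≤ μ.real A) (hb : μ.real A + δ < b) :
    c * r ≤ K * δ := by
  have h := accurateTransport_lipschitz_ge (ε := 0) hγ hT hK (μ := μ) hA hr
    (by rw [hex]; simp) (by rw [hex]; simp) hδ (by simpa using ha) (by simpa using hb)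
  simpa using h

/-- TV-closeness supplies the two set-wise hypotheses: if `|μ(S) − ν(S)| ≤ ε` for every measurable `S`
(e.g. `d_TV(μ, ν) ≤ ε`), then in particular on `A` and on `A^r`. Recorded for the reader; trivial. -/
theorem setwise_of_forall [PseudoMetricSpace X] [MeasurableSpace X] [OpensMeasurableSpace X]
    {ν μ : Measure X} {ε : ℝ} (h : ∀ S : Set X, MeasurableSet S → |μ.real S - ν.real S| ≤ ε)
    {A : Set X} (hA : MeasurableSet A) (r : ℝ) :
    |μ.real A - ν.real A| ≤ ε ∧ |μ.real (A ∪ Metric.thickening r A) - ν.real (A ∪ Metric.thickening r A)| ≤ ε :=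
  ⟨h A hA, h _ (measurableSet_union_thickening r hA)⟩

end Summit.Ventures.LatticeQCDFlow.Theory2

end
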